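import Summits.CriticalPhenomena.CardyFormulaZ2.Theorems.CardyComplexConeParafermionToSLESixFamiliesFlipRLValues
import Summits.CriticalPhenomena.CardyFormulaZ2.Theorems.CardyComplexConeParafermionToSLESixFamiliesFlipRLPhases
import Summits.CriticalPhenomena.CardyFormulaZ2.Theorems.CardyComplexConeEdgePrecompactVertexRelation
import HarnessLib

/-!
# Return law, file 5: the pair identities under the edge flip `ω ↦ ω △ {z}`
(line `flip-involution-return-law` of crux `CardyComplexCone.ParafermionToSLESixFamilies`, stmt-CriticalPhenomena-11389;
fifth helper file of the stub `stub_returnLaw`)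

For the discretisation `E` of a JORDAN Dobrushin domain, admissible, and an interior free edge `z = cTgt p`
(an edge of `Ω_δ` with both endpoints off both arcs), the three identities of the return law hold PAIRWISE
for every configuration `ω` and its flip `ω' = ω △ {z}` (registered sub-goal `returnLaw_pair`), in the
sum form `X(ω) + X(ω') = RHS(ω) + RHS(ω')` that integrates directly:

* `PS(ω) + PS(ω') = cos(π/12)·(Φ₁(ω) + Φ₁(ω')) + e^{iπ/4}·(T₊(ω) + T₊(ω')) + e^{−iπ/4}·(T₋(ω) + T₋(ω'))`,
* `IO(ω) + IO(ω') = (1 − √3/2)·(Φ₁(ω) + Φ₁(ω')) + g(1)·(T₊(ω) + T₊(ω')) + g(−1)·(T₋(ω) + T₋(ω'))`,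
* `(T₊ + T₋)(ω) + (T₊ + T₋)(ω') = (Φ₁(ω) + Φ₁(ω'))/2`,

where `PS` is the spin-`1/3` passage sum at `z`, `Φ₁ = firstPhase`, `IO = inOutSum` and `T± ` are the
integrands of `Yplus` / `Yminus` (first phase on the event "two visits, first turn `±1`"). Proof: the
trichotomy of `vertexRelation_pairSum` (neither corner of `z` on the path — both paths agree and every
quantity vanishes pairwise; once/twice with `p` or its partner first — `onceTwice_values` with the planar
input `spliceLoop_turning_eq`, which is where the Jordan hypothesis enters), followed by the algebra of
the twelve phases (`…FlipRLPhases.lean`: `pair_algebra_pos` / `pair_algebra_neg`).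
-/

noncomputable section

namespace Summit.CriticalPhenomena.CardyFormulaZ2.Cruxes.ParafermionToSLESixFamilies.FlipInvolutionReturnLaw

open MeasureTheory Filter Set Metric
open scoped BigOperators
open Literature.Probability Literature.Probability.LatticeModels Literature.Probability.Percolation
open Literature.Probability.RandomPlanarGeometry (DobrushinDomain)
open Summit.CriticalPhenomena.CardyFormulaZ2.Cruxes.EdgePrecompact.QkzStripBoundaryArm
  (forall_isInnerFace_of_not_mem_arcs spliceLoop_turning_eq exit_unique)

/-! ## The pair identities for a once/twice pair -/

/-- **The three sums on a once/twice pair** (hypotheses of `onceTwice_values`): the algebra of the twelve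
phases applied to the values, by the sign `σ = turnSign d` of the once-path at `z`. -/
theorem pair_of_onceTwice : ∀ (E : DiscreteDobrushin) (hE : E.IsZdAdmissible) (ω₁ ω₂ : BondConfig (Site 2)) (d : Site 2 × Fin 4) (i₁ Q : ℕ), (∀ e', e' ≠ cTgt d → (e' ∈ E.bcBondConfig ω₂ ↔ e' ∈ E.bcBondConfig ω₁)) → ¬ (cTgt d ∈ E.bcBondConfig ω₂ ↔ cTgt d ∈ E.bcBondConfig ω₁) → (∀ j, E.IsInnerFace (faceAt d.1 j)) → (∀ j, E.IsInnerFace (faceAt (d.1 + cornerUnit (d.2 + 1)) j)) → (∀ x ∈ cTgt d, x ∉ E.zdArcB) → cornerOrbit (E.bcBondConfig ω₁) (DiscreteDobrushin.startCorner hE) i₁ = d → i₁ < DiscreteDobrushin.exitTime hE ω₁ → (∀ i < DiscreteDobrushin.exitTime hE ω₁, cornerOrbit (E.bcBondConfig ω₁) (DiscreteDobrushin.startCorner hE) i ≠ cornerPartner d) → 0 < Q → cornerOrbit (E.bcBondConfig ω₁) (cornerPartner d) Q = cornerPartner d → (∀ s, 0 < s → s < Q → cornerOrbit (E.bcBondConfig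 ω₁) (cornerPartner d) s ≠ cornerPartner d) → ∑ m ∈ Finset.range Q, LatticeModels.turnSign (E.bcBondConfig ω₁) (cornerOrbit (E.bcBondConfig ω₁) (cornerPartner d) m) = 4 * LatticeModels.turnSign (E.bcBondConfig ω₁) d → (MedialPath.passageSum (medialExploration E ω₁) E.δ (1 / 3) (cTgt d) + MedialPath.passageSum (medialExploration E ω₂) E.δ (1 / 3) (cTgt d) = (Real.cos (Real.pi / 12) : ℂ) * (firstPhase (medialExploration E ω₁) E.δ (cTgt d) + firstPhase (medialExploration E ω₂) E.δ (cTgt d)) + Complex.exp (Complex.I * (Real.pi : ℂ) / 4) * ((if 2 ≤ (medialExploration E ω₁).count (cTgt d) ∧ FlipInvolutionReturnLaw.turnSign (medialExploration E ω₁) E.δ ((medialExploration E ω₁).idxOf (cTgt d)) = 1 then firstPhase (medialExploration E ω₁) E.δ (cTgt d) else 0) + (if 2 ≤ (medialExploration E ω₂).count (cTgt d) ∧ FlipInvolutionReturnLaw.turnSign (medialExploration E ω₂) E.δ ((medialExploration E ω₂).idxOf (cTgt d)) = 1 then firstPhase (medialExploration E ω₂) E.δ (cTgt d) else 0)) + Complex.exp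 (-(Complex.I * (Real.pi : ℂ) / 4)) * ((if 2 ≤ (medialExploration E ω₁).count (cTgt d) ∧ FlipInvolutionReturnLaw.turnSign (medialExploration E ω₁) E.δ ((medialExploration E ω₁).idxOf (cTgt d)) = -1 then firstPhase (medialExploration E ω₁) E.δ (cTgt d) else 0) + (if 2 ≤ (medialExploration E ω₂).count (cTgt d) ∧ FlipInvolutionReturnLaw.turnSign (medialExploration E ω₂) E.δ ((medialExploration E ω₂).idxOf (cTgt d)) = -1 then firstPhase (medialExploration E ω₂) E.δ (cTgt d) else 0))) ∧ (inOutSum (medialExploration E ω₁) E.δ (cTgt d) + inOutSum (medialExploration E ω₂) E.δ (cTgt d) = (1 - (Real.sqrt 3 : ℂ) / 2) * (firstPhase (medialExploration E ω₁) E.δ (cTgt d) + firstPhase (medialExploration E ω₂) E.δ (cTgt d)) + gTilt 1 * ((if 2 ≤ (medialExploration E ω₁).count (cTgt d) ∧ FlipInvolutionReturnLaw.turnSign (medialExploration E ω₁) E.δ ((medialExploration E ω₁).idxOf (cTgt d)) = 1 then firstPhase (medialExploration E ω₁) E.δ (cTgt d) else 0) + (if 2 ≤ (medialExploration E ω₂).count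 (cTgt d) ∧ FlipInvolutionReturnLaw.turnSign (medialExploration E ω₂) E.δ ((medialExploration E ω₂).idxOf (cTgt d)) = 1 then firstPhase (medialExploration E ω₂) E.δ (cTgt d) else 0)) + gTilt (-1) * ((if 2 ≤ (medialExploration E ω₁).count (cTgt d) ∧ FlipInvolutionReturnLaw.turnSign (medialExploration E ω₁) E.δ ((medialExploration E ω₁).idxOf (cTgt d)) = -1 then firstPhase (medialExploration E ω₁) E.δ (cTgt d) else 0) + (if 2 ≤ (medialExploration E ω₂).count (cTgt d) ∧ FlipInvolutionReturnLaw.turnSign (medialExploration E ω₂) E.δ ((medialExploration E ω₂).idxOf (cTgt d)) = -1 then firstPhase (medialExploration E ω₂) E.δ (cTgt d) else 0))) ∧ (((if 2 ≤ (medialExploration E ω₁).count (cTgt d) ∧ FlipInvolutionReturnLaw.turnSign (medialExploration E ω₁) E.δ ((medialExploration E ω₁).idxOf (cTgt d)) = 1 then firstPhase (medialExploration E ω₁) E.δ (cTgt d) else 0) + (if 2 ≤ (medialExploration E ω₁).count (cTgt d) ∧ FlipInvolutionReturnLaw.turnSign (medialExploration E ω₁) E.δ ((medialExploration E ω₁).idxOf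 (cTgt d)) = -1 then firstPhase (medialExploration E ω₁) E.δ (cTgt d) else 0)) + ((if 2 ≤ (medialExploration E ω₂).count (cTgt d) ∧ FlipInvolutionReturnLaw.turnSign (medialExploration E ω₂) E.δ ((medialExploration E ω₂).idxOf (cTgt d)) = 1 then firstPhase (medialExploration E ω₂) E.δ (cTgt d) else 0) + (if 2 ≤ (medialExploration E ω₂).count (cTgt d) ∧ FlipInvolutionReturnLaw.turnSign (medialExploration E ω₂) E.δ ((medialExploration E ω₂).idxOf (cTgt d)) = -1 then firstPhase (medialExploration E ω₂) E.δ (cTgt d) else 0)) = (firstPhase (medialExploration E ω₁) E.δ (cTgt d) + firstPhase (medialExploration E ω₂) E.δ (cTgt d)) / 2) := by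
  intro E hE ω₁ ω₂ d i₁ Q hagree hdiff hx hy hB hi₁ hi₁N h₂ hQ0 hQ hQmin hT
  classical
  obtain ⟨⟨hPS₁, hPS₂⟩, ⟨hF₁, hF₂⟩, ⟨hc₁, hc₂⟩, ⟨hidx₁, hidx₂, hτ₁, hτ₂⟩, ⟨hIO₁, hIO₂⟩⟩ :=
    onceTwice_values E hE ω₁ ω₂ d i₁ Q hagree hdiff hx hy hB hi₁ hi₁N h₂ hQ0 hQ hQmin hT
  -- the indicator terms: never on the once-path, on the twice-path according to the first turn `−σ`
  have hT₁ : ∀ c : ℝ, (if 2 ≤ (medialExploration E ω₁).count (cTgt d) ∧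
      FlipInvolutionReturnLaw.turnSign (medialExploration E ω₁) E.δ ((medialExploration E ω₁).idxOf (cTgt d)) = c
        then firstPhase (medialExploration E ω₁) E.δ (cTgt d) else 0) = 0 := by
    intro c
    rw [if_neg]
    rw [hc₁]
    omega
  have hT₂ : ∀ c : ℝ, (if 2 ≤ (medialExploration E ω₂).count (cTgt d) ∧
      FlipInvolutionReturnLaw.turnSign (medialExploration E ω₂) E.δ ((medialExploration E ω₂).idxOf (cTgt d)) = c
        then firstPhase (medialExploration E ω₂) E.δ (cTgt d) else 0) =
      if -(LatticeModels.turnSign (E.bcBondConfig ω₁) d : ℝ) = c then phase (Real.pi / 2 * (turnCount (E.bcBondConfig ω₁) (DiscreteDobrushin.startCorner hE) i₁ : ℝ)) else 0 := by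
    intro c
    by_cases h : -(LatticeModels.turnSign (E.bcBondConfig ω₁) d : ℝ) = c
    · rw [if_pos h, if_pos, hF₂]
      rw [hc₂, hidx₂, hτ₂]
      exact ⟨le_rfl, h⟩
    · rw [if_neg h, if_neg]
      rw [hidx₂, hτ₂]
      exact fun h' => h h'.2
  rw [hT₁, hT₁, hT₂, hT₂]
  by_cases hm : cTgt d ∈ E.bcBondConfig ω₁
  · -- `σ = −1`: the once-path follows `z`
    have hσ : LatticeModels.turnSign (E.bcBondConfig ω₁) d = -1 := turnSign_of_mem hm
    rw [hσ] at hPS₁ hPS₂ hIO₁ hIO₂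
    rw [hσ]
    have e1 : (if -(((-1 : ℤ) : ℝ)) = (1 : ℝ) then phase (Real.pi / 2 * (turnCount (E.bcBondConfig ω₁) (DiscreteDobrushin.startCorner hE) i₁ : ℝ)) else 0) =
        phase (Real.pi / 2 * (turnCount (E.bcBondConfig ω₁) (DiscreteDobrushin.startCorner hE) i₁ : ℝ)) := by
      rw [if_pos]; norm_num
    have e2 : (if -(((-1 : ℤ) : ℝ)) = (-1 : ℝ) then phase (Real.pi / 2 * (turnCount (E.bcBondConfig ω₁) (DiscreteDobrushin.startCorner hE) i₁ : ℝ)) else 0) = 0 := by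
      rw [if_neg]; norm_num
    rw [e1, e2]
    exact pair_algebra_neg _ _ _ _ _ _ _ _ _ _ _ hPS₁ hPS₂ hF₁ hF₂ rfl rfl rfl rfl hIO₁ hIO₂
  · -- `σ = +1`: the once-path crosses `z`
    have hσ : LatticeModels.turnSign (E.bcBondConfig ω₁) d = 1 := turnSign_of_not_mem hm
    rw [hσ] at hPS₁ hPS₂ hIO₁ hIO₂
    rw [hσ]
    have e1 : (if -(((1 : ℤ) : ℝ)) = (1 : ℝ) then phase (Real.pi / 2 * (turnCount (E.bcBondConfig ω₁) (DiscreteDobrushin.startCorner hE) i₁ : ℝ)) else 0) = 0 := by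
      rw [if_neg]; norm_num
    have e2 : (if -(((1 : ℤ) : ℝ)) = (-1 : ℝ) then phase (Real.pi / 2 * (turnCount (E.bcBondConfig ω₁) (DiscreteDobrushin.startCorner hE) i₁ : ℝ)) else 0) =
        phase (Real.pi / 2 * (turnCount (E.bcBondConfig ω₁) (DiscreteDobrushin.startCorner hE) i₁ : ℝ)) := by
      rw [if_pos]; norm_num
    rw [e1, e2]
    exact pair_algebra_pos _ _ _ _ _ _ _ _ _ _ _ hPS₁ hPS₂ hF₁ hF₂ rfl rfl rfl rfl hIO₁ hIO₂

/-! ## The pair identities under the edge flip -/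

/-- **The return law, pairwise under the flip** (registered sub-goal `returnLaw_pair` of
stmt-CriticalPhenomena-11389, line `flip-involution-return-law`). For the discretisation `E` of a Jordan
Dobrushin domain (`E.Ω = D.carrier`), admissible, an interior free edge `z = cTgt p` (edge of `Ω_δ`, both
endpoints off both arcs) and every configuration `ω`, with `ω' = ω △ {z}`: the passage sums, the
in-minus-out sums and the return indicators of `ω` and `ω'` at `z` satisfy the three identities of the
return law in sum form (module docstring). Trichotomy: if neither corner of `z` is a dart of the path of
`ω`, the two paths coincide (`cornerOrbit_toggle_case0`) and all terms vanish; otherwise `(ω, ω')` or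
`(ω', ω)` is a once/twice pair at the first-arriving corner (`cornerOrbit_toggle_case2` /
`exit_toggle_case2` for the excised stretch), the loop of the partner turns by `4σ`
(`spliceLoop_turning_eq`, Jordan), and `pair_of_onceTwice` applies. -/
theorem returnLaw_pair : ∀ (D : DobrushinDomain) (E : DiscreteDobrushin), E.Ω = D.carrier → ∀ (hE : E.IsZdAdmissible) (p : Site 2 × Fin 4), cTgt p ∈ (discreteDomainGraph E.Ω E.δ).edgeSet → (∀ y ∈ cTgt p, y ∉ E.zdArcA ∧ y ∉ E.zdArcB) → ∀ ω : BondConfig (Site 2), let γ := medialExploration E ω; let γ' := medialExploration E (symmDiff ω {cTgt p}); let z := cTgt p; (MedialPath.passageSum γ E.δ (1 / 3) z + MedialPath.passageSum γ' E.δ (1 / 3) z = (Real.cos (Real.pi / 12) : ℂ) * (firstPhase γ E.δ z + firstPhase γ' E.δ z) + Complex.exp (Complex.I * (Real.pi : ℂ) / 4) * ((if 2 ≤ γ.count z ∧ FlipInvolutionReturnLaw.turnSign γ E.δ (γ.idxOf z) = 1 then firstPhase γ E.δ z else 0) + (if 2 ≤ γ'.count z ∧ FlipInvolutionReturnLaw.turnSign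 γ' E.δ (γ'.idxOf z) = 1 then firstPhase γ' E.δ z else 0)) + Complex.exp (-(Complex.I * (Real.pi : ℂ) / 4)) * ((if 2 ≤ γ.count z ∧ FlipInvolutionReturnLaw.turnSign γ E.δ (γ.idxOf z) = -1 then firstPhase γ E.δ z else 0) + (if 2 ≤ γ'.count z ∧ FlipInvolutionReturnLaw.turnSign γ' E.δ (γ'.idxOf z) = -1 then firstPhase γ' E.δ z else 0))) ∧ (inOutSum γ E.δ z + inOutSum γ' E.δ z = (1 - (Real.sqrt 3 : ℂ) / 2) * (firstPhase γ E.δ z + firstPhase γ' E.δ z) + gTilt 1 * ((if 2 ≤ γ.count z ∧ FlipInvolutionReturnLaw.turnSign γ E.δ (γ.idxOf z) = 1 then firstPhase γ E.δ z else 0) + (if 2 ≤ γ'.count z ∧ FlipInvolutionReturnLaw.turnSign γ' E.δ (γ'.idxOf z) = 1 then firstPhase γ' E.δ z else 0)) + gTilt (-1) * ((if 2 ≤ γ.count z ∧ FlipInvolutionReturnLaw.turnSign γ E.δ (γ.idxOf z) = -1 then firstPhase γ E.δ z else 0) + (if 2 ≤ γ'.count z ∧ FlipInvolutionReturnLaw.turnSign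 γ' E.δ (γ'.idxOf z) = -1 then firstPhase γ' E.δ z else 0))) ∧ (((if 2 ≤ γ.count z ∧ FlipInvolutionReturnLaw.turnSign γ E.δ (γ.idxOf z) = 1 then firstPhase γ E.δ z else 0) + (if 2 ≤ γ.count z ∧ FlipInvolutionReturnLaw.turnSign γ E.δ (γ.idxOf z) = -1 then firstPhase γ E.δ z else 0)) + ((if 2 ≤ γ'.count z ∧ FlipInvolutionReturnLaw.turnSign γ' E.δ (γ'.idxOf z) = 1 then firstPhase γ' E.δ z else 0) + (if 2 ≤ γ'.count z ∧ FlipInvolutionReturnLaw.turnSign γ' E.δ (γ'.idxOf z) = -1 then firstPhase γ' E.δ z else 0)) = (firstPhase γ E.δ z + firstPhase γ' E.δ z) / 2) := by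
  intro D E hΩ hE p hz hAB ω
  dsimp only
  classical
  -- endpoints, faces, the flip
  have hxA := (hAB p.1 (Sym2.mem_mk_left _ _)).1
  have hxB := (hAB p.1 (Sym2.mem_mk_left _ _)).2
  have hyA := (hAB (p.1 + cornerUnit (p.2 + 1)) (Sym2.mem_mk_right _ _)).1
  have hyB := (hAB (p.1 + cornerUnit (p.2 + 1)) (Sym2.mem_mk_right _ _)).2
  have hB : ∀ x ∈ cTgt p, x ∉ E.zdArcB := fun x hx' => (hAB x hx').2
  have hB₂ : ∀ x ∈ cTgt (cornerPartner p), x ∉ E.zdArcB := by rw [cTgt_partner]; exact hB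
  have hbc : ∀ ω₁ : BondConfig (Site 2), cTgt p ∈ E.bcBondConfig ω₁ ↔ cTgt p ∈ ω₁ := by
    intro ω₁
    rw [DiscreteDobrushin.mem_bcBondConfig_iff]
    constructor
    · rintro ⟨-, h | ⟨h, -⟩⟩
      · exact absurd (h p.1 (Sym2.mem_mk_left _ _)) hxA
      · exact h
    · intro h
      exact ⟨hz, Or.inr ⟨h, fun y hy' => (hAB y hy').2⟩⟩
  have hagree : ∀ e', e' ≠ cTgt p → (e' ∈ E.bcBondConfig (symmDiff ω {cTgt p}) ↔ e' ∈ E.bcBondConfig ω) := by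
    intro e' he'
    simp only [DiscreteDobrushin.mem_bcBondConfig_iff, Set.mem_symmDiff, Set.mem_singleton_iff, he', not_false_eq_true,
      and_true, false_and, or_false]
  have hdiff : ¬ (cTgt p ∈ E.bcBondConfig (symmDiff ω {cTgt p}) ↔ cTgt p ∈ E.bcBondConfig ω) := by
    rw [hbc, hbc, Set.mem_symmDiff]
    simp
  have hagree' : ∀ e', e' ≠ cTgt p → (e' ∈ E.bcBondConfig ω ↔ e' ∈ E.bcBondConfig (symmDiff ω {cTgt p})) :=
    fun e' he' => (hagree e' he').symm
  have hdiff' : ¬ (cTgt p ∈ E.bcBondConfig ω ↔ cTgt p ∈ E.bcBondConfig (symmDiff ω {cTgt p})) := fun h => hdiff h.symm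
  have hagree₂ : ∀ e', e' ≠ cTgt (cornerPartner p) → (e' ∈ E.bcBondConfig (symmDiff ω {cTgt p}) ↔ e' ∈ E.bcBondConfig ω) := by
    rw [cTgt_partner]; exact hagree
  have hdiff₂ : ¬ (cTgt (cornerPartner p) ∈ E.bcBondConfig (symmDiff ω {cTgt p}) ↔ cTgt (cornerPartner p) ∈ E.bcBondConfig ω) := by
    rw [cTgt_partner]; exact hdiff
  have hagree₂' : ∀ e', e' ≠ cTgt (cornerPartner p) → (e' ∈ E.bcBondConfig ω ↔ e' ∈ E.bcBondConfig (symmDiff ω {cTgt p})) :=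
    fun e' he' => (hagree₂ e' he').symm
  have hdiff₂' : ¬ (cTgt (cornerPartner p) ∈ E.bcBondConfig ω ↔ cTgt (cornerPartner p) ∈ E.bcBondConfig (symmDiff ω {cTgt p})) :=
    fun h => hdiff₂ h.symm
  -- the cut orbits
  set c₀ := DiscreteDobrushin.startCorner hE with hc₀def
  have hc₀ : E.IsStartCorner c₀ := DiscreteDobrushin.isStartCorner_startCorner hE
  set N := DiscreteDobrushin.exitTime hE ω with hNdef
  set N' := DiscreteDobrushin.exitTime hE (symmDiff ω {cTgt p}) with hN'def
  have hN := DiscreteDobrushin.not_isInnerFace_exitTime hE ω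
  have hlt : ∀ k < N, E.IsInnerFace (cFace (cornerOrbit (E.bcBondConfig ω) c₀ k)) := fun k hk =>
    DiscreteDobrushin.isInnerFace_of_lt_exitTime hE ω hk
  have hN' := DiscreteDobrushin.not_isInnerFace_exitTime hE (symmDiff ω {cTgt p})
  have hlt' : ∀ k < N', E.IsInnerFace (cFace (cornerOrbit (E.bcBondConfig (symmDiff ω {cTgt p})) c₀ k)) := fun k hk =>
    DiscreteDobrushin.isInnerFace_of_lt_exitTime hE _ hk
  rw [← hNdef] at hN
  rw [← hN'def] at hN'
  have hinj : ∀ a b, a < N → b < N → cornerOrbit (E.bcBondConfig ω) c₀ a = cornerOrbit (E.bcBondConfig ω) c₀ b → a = b := by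
    intro a b ha hb h
    by_contra hne
    rcases Nat.lt_or_gt_of_ne hne with hab | hab
    · exact cornerOrbit_ne hE hc₀ hab (fun k hk => hlt k (by omega)) h
    · exact cornerOrbit_ne hE hc₀ hab (fun k hk => hlt k (by omega)) h.symm
  -- all faces at both endpoints are inner as soon as one of the two corners of `z` is a dart of the path
  have hp₂x : (cornerPartner p).1 + cornerUnit ((cornerPartner p).2 + 1) = p.1 :=
    congrArg Prod.fst (Summit.CriticalPhenomena.CardyFormulaZ2.Cruxes.EdgePrecompact.QkzStripBoundaryArm.partner_Y p)
  have faces : (∃ i < N, cornerOrbit (E.bcBondConfig ω) c₀ i = p ∨ cornerOrbit (E.bcBondConfig ω) c₀ i = cornerPartner p) →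
      (∀ j, E.IsInnerFace (faceAt p.1 j)) ∧ (∀ j, E.IsInnerFace (faceAt (p.1 + cornerUnit (p.2 + 1)) j)) := by
    rintro ⟨i, hi, h⟩
    have hin := hlt i hi
    have hx : ∀ j, E.IsInnerFace (faceAt p.1 j) := by
      rcases h with h | h
      · rw [h] at hin
        exact forall_isInnerFace_of_not_mem_arcs hE hxA hxB (j₀ := p.2) hin
      · rw [h] at hin
        have : E.IsInnerFace (faceAt p.1 (p.2 + 1)) := by
          have e : cFace (cornerPartner p) = faceAt p.1 (p.2 + 1) := by
            show faceAt (p.1 + cornerUnit (p.2 + 1)) (p.2 + 2) = _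
            rw [← faceAt_add_unit_succ p.1 (p.2 + 1)]
            congr 1
            abel
          rw [← e]; exact hin
        exact forall_isInnerFace_of_not_mem_arcs hE hxA hxB (j₀ := p.2 + 1) this
    refine ⟨hx, ?_⟩
    have : E.IsInnerFace (faceAt (p.1 + cornerUnit (p.2 + 1)) (p.2 + 1 + 1)) := by
      rw [faceAt_add_unit_succ]; exact hx _
    exact forall_isInnerFace_of_not_mem_arcs hE hyA hyB (j₀ := p.2 + 1 + 1) this
  by_cases hp : ∃ i₁ < N, cornerOrbit (E.bcBondConfig ω) c₀ i₁ = p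
  · obtain ⟨i₁, hi₁N, hi₁⟩ := hp
    obtain ⟨hx, hy⟩ := faces ⟨i₁, hi₁N, Or.inl hi₁⟩
    have hy' : ∀ j, E.IsInnerFace (faceAt ((cornerPartner p).1 + cornerUnit ((cornerPartner p).2 + 1)) j) := by
      rw [hp₂x]; exact hx
    by_cases hp₂ : ∃ i₂ < N, cornerOrbit (E.bcBondConfig ω) c₀ i₂ = cornerPartner p
    · -- both corners on the path of `ω`: `ω` is the twice-path, `ω'` the once-path (case 2)
      obtain ⟨i₂, hi₂N, hi₂⟩ := hp₂
      have hne : i₁ ≠ i₂ := by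
        rintro rfl
        exact partner_ne p (hi₂.symm.trans hi₁)
      -- generic case-2 analysis for a first-arriving corner `d` at time `a` and its partner at time `b > a`
      have case2 : ∀ (d : Site 2 × Fin 4) (a b : ℕ), cTgt d = cTgt p →
          (∀ e', e' ≠ cTgt d → (e' ∈ E.bcBondConfig (symmDiff ω {cTgt p}) ↔ e' ∈ E.bcBondConfig ω)) →
          ¬ (cTgt d ∈ E.bcBondConfig (symmDiff ω {cTgt p}) ↔ cTgt d ∈ E.bcBondConfig ω) →
          (∀ j, E.IsInnerFace (faceAt d.1 j)) → (∀ j, E.IsInnerFace (faceAt (d.1 + cornerUnit (d.2 + 1)) j)) →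
          (∀ x ∈ cTgt d, x ∉ E.zdArcB) →
          cornerOrbit (E.bcBondConfig ω) c₀ a = d → cornerOrbit (E.bcBondConfig ω) c₀ b = cornerPartner d → a < b → b < N →
          (MedialPath.passageSum (medialExploration E (symmDiff ω {cTgt p})) E.δ (1 / 3) (cTgt d) + MedialPath.passageSum (medialExploration E ω) E.δ (1 / 3) (cTgt d) = (Real.cos (Real.pi / 12) : ℂ) * (firstPhase (medialExploration E (symmDiff ω {cTgt p})) E.δ (cTgt d) + firstPhase (medialExploration E ω) E.δ (cTgt d)) + Complex.exp (Complex.I * (Real.pi : ℂ) / 4) * ((if 2 ≤ (medialExploration E (symmDiff ω {cTgt p})).count (cTgt d) ∧ FlipInvolutionReturnLaw.turnSign (medialExploration E (symmDiff ω {cTgt p})) E.δ ((medialExploration E (symmDiff ω {cTgt p})).idxOf (cTgt d)) = 1 then firstPhase (medialExploration E (symmDiff ω {cTgt p})) E.δ (cTgt d) else 0) + (if 2 ≤ (medialExploration E ω).count (cTgt d) ∧ FlipInvolutionReturnLaw.turnSign (medialExploration E ω) E.δ ((medialExploration E ω).idxOf (cTgt d)) = 1 then firstPhase (medialExploration E ω)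 E.δ (cTgt d) else 0)) + Complex.exp (-(Complex.I * (Real.pi : ℂ) / 4)) * ((if 2 ≤ (medialExploration E (symmDiff ω {cTgt p})).count (cTgt d) ∧ FlipInvolutionReturnLaw.turnSign (medialExploration E (symmDiff ω {cTgt p})) E.δ ((medialExploration E (symmDiff ω {cTgt p})).idxOf (cTgt d)) = -1 then firstPhase (medialExploration E (symmDiff ω {cTgt p})) E.δ (cTgt d) else 0) + (if 2 ≤ (medialExploration E ω).count (cTgt d) ∧ FlipInvolutionReturnLaw.turnSign (medialExploration E ω) E.δ ((medialExploration E ω).idxOf (cTgt d)) = -1 then firstPhase (medialExploration E ω) E.δ (cTgt d) else 0))) ∧ (inOutSum (medialExploration E (symmDiff ω {cTgt p})) E.δ (cTgt d) + inOutSum (medialExploration E ω) E.δ (cTgt d) = (1 - (Real.sqrt 3 : ℂ) / 2) * (firstPhase (medialExploration E (symmDiff ω {cTgt p})) E.δ (cTgt d) + firstPhase (medialExploration E ω) E.δ (cTgt d)) + gTilt 1 * ((if 2 ≤ (medialExploration E (symmDiff ω {cTgt p})).count (cTgt d) ∧ FlipInvolutionReturnLaw.turnSign (medialExploration E (symmDiff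 ω {cTgt p})) E.δ ((medialExploration E (symmDiff ω {cTgt p})).idxOf (cTgt d)) = 1 then firstPhase (medialExploration E (symmDiff ω {cTgt p})) E.δ (cTgt d) else 0) + (if 2 ≤ (medialExploration E ω).count (cTgt d) ∧ FlipInvolutionReturnLaw.turnSign (medialExploration E ω) E.δ ((medialExploration E ω).idxOf (cTgt d)) = 1 then firstPhase (medialExploration E ω) E.δ (cTgt d) else 0)) + gTilt (-1) * ((if 2 ≤ (medialExploration E (symmDiff ω {cTgt p})).count (cTgt d) ∧ FlipInvolutionReturnLaw.turnSign (medialExploration E (symmDiff ω {cTgt p})) E.δ ((medialExploration E (symmDiff ω {cTgt p})).idxOf (cTgt d)) = -1 then firstPhase (medialExploration E (symmDiff ω {cTgt p})) E.δ (cTgt d) else 0) + (if 2 ≤ (medialExploration E ω).count (cTgt d) ∧ FlipInvolutionReturnLaw.turnSign (medialExploration E ω) E.δ ((medialExploration E ω).idxOf (cTgt d)) = -1 then firstPhase (medialExploration E ω) E.δ (cTgt d) else 0))) ∧ (((if 2 ≤ (medialExploration E (symmDiff ω {cTgt p})).count (cTgt d) ∧ FlipInvolutionReturnLaw.turnSign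 (medialExploration E (symmDiff ω {cTgt p})) E.δ ((medialExploration E (symmDiff ω {cTgt p})).idxOf (cTgt d)) = 1 then firstPhase (medialExploration E (symmDiff ω {cTgt p})) E.δ (cTgt d) else 0) + (if 2 ≤ (medialExploration E (symmDiff ω {cTgt p})).count (cTgt d) ∧ FlipInvolutionReturnLaw.turnSign (medialExploration E (symmDiff ω {cTgt p})) E.δ ((medialExploration E (symmDiff ω {cTgt p})).idxOf (cTgt d)) = -1 then firstPhase (medialExploration E (symmDiff ω {cTgt p})) E.δ (cTgt d) else 0)) + ((if 2 ≤ (medialExploration E ω).count (cTgt d) ∧ FlipInvolutionReturnLaw.turnSign (medialExploration E ω) E.δ ((medialExploration E ω).idxOf (cTgt d)) = 1 then firstPhase (medialExploration E ω) E.δ (cTgt d) else 0) + (if 2 ≤ (medialExploration E ω).count (cTgt d) ∧ FlipInvolutionReturnLaw.turnSign (medialExploration E ω) E.δ ((medialExploration E ω).idxOf (cTgt d)) = -1 then firstPhase (medialExploration E ω) E.δ (cTgt d) else 0)) = (firstPhase (medialExploration E (symmDiff ω {cTgt p})) E.δ (cTgt d) + firstPhase (medialExploration E ω) E.δ (cTgt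 d)) / 2) := by
        intro d a b hd hagree_d hdiff_d hx_d hy_d hB_d ha hb hab hbN
        -- adapted from `pairSum_case2` (Theorems/CardyComplexConeEdgePrecompactVertexRelationPairSum.lean)
        have hstep : ∀ (β : BondConfig (Site 2)) (c : Site 2 × Fin 4) (i : ℕ),
            cornerOrbit β c (i + 1) = nextCorner β (cornerOrbit β c i) := fun _ _ _ => rfl
        obtain ⟨hpre, hshift⟩ := cornerOrbit_toggle_case2 hE hc₀ hagree_d hdiff_d hlt ha hb hab hbN
        obtain ⟨hN'', hlt''⟩ := exit_toggle_case2 hE hc₀ hagree_d hdiff_d hN hlt ha hb hab hbN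
        have hNeq : N' = N - (b - a) := exit_unique hN' hlt' hN'' hlt''
        have hloop : ∀ j, j + 1 ≤ b - a →
            cornerOrbit (E.bcBondConfig (symmDiff ω {cTgt p})) (cornerPartner d) (j + 1) = cornerOrbit (E.bcBondConfig ω) c₀ (a + 1 + j) := by
          intro j hj
          induction j with
          | zero =>
            rw [hstep _ _ 0, cornerOrbit_zero', nextCorner_toggle hagree_d hdiff_d, Equiv.swap_apply_right, add_zero, hstep, ha]
          | succ j ih =>
            rw [show a + 1 + (j + 1) = a + 1 + j + 1 by omega, hstep _ _ (j + 1), hstep _ c₀ (a + 1 + j), ih (by omega),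
              nextCorner_toggle_of_ne hagree_d hdiff_d]
            · intro h; have := hinj _ _ (by omega) (by omega) (h.trans ha.symm); omega
            · intro h; have := hinj _ _ (by omega) hbN (h.trans hb.symm); omega
        have hQ' : cornerOrbit (E.bcBondConfig (symmDiff ω {cTgt p})) (cornerPartner d) (b - a) = cornerPartner d := by
          have := hloop (b - a - 1) (by omega)
          rwa [show b - a - 1 + 1 = b - a by omega, show a + 1 + (b - a - 1) = b by omega, hb] at this
        have hQmin' : ∀ s, 0 < s → s < b - a → cornerOrbit (E.bcBondConfig (symmDiff ω {cTgt p})) (cornerPartner d) s ≠ cornerPartner d := by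
          intro s hs hsQ h
          have := hloop (s - 1) (by omega)
          rw [show s - 1 + 1 = s by omega, h, ← hb] at this
          have := hinj _ _ hbN (by omega) this; omega
        have h₂' : ∀ i < N', cornerOrbit (E.bcBondConfig (symmDiff ω {cTgt p})) c₀ i ≠ cornerPartner d := by
          intro i hi h
          rw [hNeq] at hi
          by_cases hii : i ≤ a
          · rw [hpre i hii, ← hb] at h
            have := hinj _ _ (by omega) hbN h; omega
          · have hs := hshift (i - a - 1) (by omega)
            rw [show a + 1 + (i - a - 1) = i by omega] at hs
            rw [hs, ← hb] at h
            have := hinj _ _ (by omega) hbN h; omega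
        have ha' : cornerOrbit (E.bcBondConfig (symmDiff ω {cTgt p})) c₀ a = d := (hpre a le_rfl).trans ha
        have haN' : a < N' := by rw [hNeq]; omega
        have hN'2 : ¬ E.IsInnerFace (cFace (cornerOrbit (E.bcBondConfig (symmDiff ω {cTgt p})) c₀ N')) := hN'
        have hT := spliceLoop_turning_eq D E hΩ hE (symmDiff ω {cTgt p}) c₀ d N' a (b - a) hc₀ hN'2 hlt' ha' haN' h₂' hy_d
          (by omega) hQ' hQmin'
        exact pair_of_onceTwice E hE (symmDiff ω {cTgt p}) ω d a (b - a) (fun e' he' => (hagree_d e' he').symm)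
          (fun h => hdiff_d h.symm) hx_d hy_d hB_d ha' haN' h₂' (by omega) hQ' hQmin' hT
      rcases Nat.lt_or_gt_of_ne hne with h12 | h21
      · obtain ⟨e1, e2, e3⟩ := case2 p i₁ i₂ rfl hagree hdiff hx hy hB hi₁ hi₂ h12 hi₂N
        exact ⟨by linear_combination e1, by linear_combination e2, by linear_combination e3⟩
      · obtain ⟨e1, e2, e3⟩ := case2 (cornerPartner p) i₂ i₁ (cTgt_partner p) hagree₂ hdiff₂ hy hy' hB₂ hi₂
          (by rw [partner_partner]; exact hi₁) h21 hi₁N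
        rw [cTgt_partner] at e1 e2 e3
        exact ⟨by linear_combination e1, by linear_combination e2, by linear_combination e3⟩
    · -- `p` on the path of `ω`, its partner not: `ω` is the once-path (case 1)
      push Not at hp₂
      have hmesh : (cornerPartner p).1 ∈ meshDomain E.Ω E.δ := fst_mem_meshDomain_of_isInnerFace (q := cornerPartner p) (hy _)
      obtain ⟨Q, hQ0, hQ, hQmin⟩ := Summit.CriticalPhenomena.CardyFormulaZ2.Cruxes.EdgePrecompact.QkzStripBoundaryArm.exists_min_period
        (exists_cornerOrbit_period (ω := ω) hE hmesh)
      have hT := spliceLoop_turning_eq D E hΩ hE ω c₀ p N i₁ Q hc₀ hN hlt hi₁ hi₁N hp₂ hy hQ0 hQ hQmin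
      exact pair_of_onceTwice E hE ω (symmDiff ω {cTgt p}) p i₁ Q hagree hdiff hx hy hB hi₁ hi₁N hp₂ hQ0 hQ hQmin hT
  · push Not at hp
    by_cases hp₂ : ∃ i₂ < N, cornerOrbit (E.bcBondConfig ω) c₀ i₂ = cornerPartner p
    · -- the partner on the path of `ω`, `p` not: `ω` is the once-path at the partner (case 1)
      obtain ⟨i₂, hi₂N, hi₂⟩ := hp₂
      obtain ⟨hx, hy⟩ := faces ⟨i₂, hi₂N, Or.inr hi₂⟩
      have hy' : ∀ j, E.IsInnerFace (faceAt ((cornerPartner p).1 + cornerUnit ((cornerPartner p).2 + 1)) j) := by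
        rw [hp₂x]; exact hx
      have hp' : ∀ i < N, cornerOrbit (E.bcBondConfig ω) c₀ i ≠ cornerPartner (cornerPartner p) := by
        rw [partner_partner]; exact hp
      have hmesh : (cornerPartner (cornerPartner p)).1 ∈ meshDomain E.Ω E.δ :=
        fst_mem_meshDomain_of_isInnerFace (q := cornerPartner (cornerPartner p)) (hy' _)
      obtain ⟨Q, hQ0, hQ, hQmin⟩ := Summit.CriticalPhenomena.CardyFormulaZ2.Cruxes.EdgePrecompact.QkzStripBoundaryArm.exists_min_period
        (exists_cornerOrbit_period (ω := ω) hE hmesh)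
      have hT := spliceLoop_turning_eq D E hΩ hE ω c₀ (cornerPartner p) N i₂ Q hc₀ hN hlt hi₂ hi₂N hp' hy' hQ0 hQ hQmin
      obtain ⟨e1, e2, e3⟩ := pair_of_onceTwice E hE ω (symmDiff ω {cTgt p}) (cornerPartner p) i₂ Q hagree₂ hdiff₂ hy hy' hB₂ hi₂
        hi₂N hp' hQ0 hQ hQmin hT
      rw [cTgt_partner] at e1 e2 e3
      exact ⟨e1, e2, e3⟩
    · -- neither corner of `z` is a dart: the two paths coincide and every term vanishes
      push Not at hp₂
      have h0 := cornerOrbit_toggle_case0 hagree hdiff (N := N) hp hp₂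
      have hNeq : N' = N := exit_unique hN' hlt' (by rw [h0 N le_rfl]; exact hN) (fun k hk => by rw [h0 k hk.le]; exact hlt k hk)
      have hV : (Finset.range N).filter (fun j => cornerOrbit (E.bcBondConfig ω) c₀ j = p ∨
          cornerOrbit (E.bcBondConfig ω) c₀ j = cornerPartner p) = ∅ := by
        rw [Finset.filter_eq_empty_iff]
        intro j hj h
        rw [Finset.mem_range] at hj
        rcases h with h | h
        · exact hp j hj h
        · exact hp₂ j hj h
      have hV' : (Finset.range N').filter (fun j => cornerOrbit (E.bcBondConfig (symmDiff ω {cTgt p})) c₀ j = p ∨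
          cornerOrbit (E.bcBondConfig (symmDiff ω {cTgt p})) c₀ j = cornerPartner p) = ∅ := by
        rw [Finset.filter_eq_empty_iff]
        intro j hj h
        rw [Finset.mem_range, hNeq] at hj
        rw [h0 j hj.le] at h
        rcases h with h | h
        · exact hp j hj h
        · exact hp₂ j hj h
      obtain ⟨hPS, hcount, hIO, hF, -⟩ := visit_dictionary E hE ω p hB
      obtain ⟨hPS', hcount', hIO', hF', -⟩ := visit_dictionary E hE (symmDiff ω {cTgt p}) p hB
      rw [← hc₀def, ← hNdef, hV] at hPS hcount hIO hF
      rw [← hc₀def, ← hN'def, hV'] at hPS' hcount' hIO' hF'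
      have hF0 := hF rfl
      have hF0' := hF' rfl
      rw [Finset.sum_empty] at hPS hIO hPS' hIO'
      rw [hPS, hPS', hIO, hIO', hF0, hF0']
      simp only [ite_self, add_zero, mul_zero, zero_div]
      exact ⟨trivial, trivial, trivial⟩

end Summit.CriticalPhenomena.CardyFormulaZ2.Cruxes.ParafermionToSLESixFamilies.FlipInvolutionReturnLaw

end
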